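import Summits.ResolutionOfSingularities.ResolutionOfSingularities.Theorems.MarkedTransferCampaignW36SymbolicFGDefs
import Literature.AlgebraicGeometry.Hironaka2017.Proofs.S06BaseHike.Thm6p6b
import Literature.AlgebraicGeometry.Hironaka2017.Proofs.S04CharAlgebra.U16L38Holds
import HarnessLib

/-!
# [L1 W3.6 · SYMBOLIC-FG DOOR] «`U30_2_R2_inst`| SymbolicFG» holds BINDER-FREE: a core focusing `Ě` of `Ê` exists whenever the symbolic
# algebra of `Σ̄_max(Ê)` is finitely generated on the affine opens — a door containing the W3.6 door «`U30_2_R2_inst`|𝒞»; and the class is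
# also NECESSARY (tree theorems `U16_1_holds`, `isStandard_of_isCoreFocus_baseHike`, res-type-010's `U30L4fSymbolicFG`): at every guarded
# instance «`Ě` exists ⟺ symbolic algebra of `Σ̄_max(Ê)` finitely generated» — R12/12a's residual is EXACTLY a finite-generation property

Cell `res-hironaka`, rung L, slot W3.6 lineage (seat res-L1-s36-pv-1, g1); GAP-LEDGER R12/12a residual ⟨StableTower⟩ OFF the class
`𝒞 = LCIOrMonomialClass`. HOST item stmt-ResolutionOfSingularities-16155 via `--supports`. HONEST FRAMING (D-0012/D-0089): kernel theorems
about OUR typed statements and carriers (o4's Hat family / `CoreFocusExistsOn` / `CampaignW36CoreFocusExistsOnI` p487786, res-type-010's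
`diffPower` / `StableAt` / `IsCoreFocus` and `U30L4fSymbolicFG` p488059, row 003's `familySubalgebra` and typed `U16_1`, this seat's
`SymbolicFGClass` and `MarkedTransferCampaignW36SymbolicFG` p525679). Nothing printed in [Hironaka2017] is asserted — the manuscript prints no
existence argument for `Ě` (§6.2 p.30 l.4–9) — and the manuscript stays «under review». AI-produced; weaker than expert review.

CONTENTS.
* `symbolicFGClass_of_lciOrMonomialClass` — on every ambient datum, 𝒞 ⊆ SymbolicFG (T-AB p494780 ∘ HHT (b) ⇒ (a)).
* **`coreFocusExistsOn_symbolicFG_of_hatUscCutOn`** — ⟨UscCut⟩|SymbolicFG ⇒ `Ě` exists on SymbolicFG (`exists_isCoreFocus_of_symbolicAlgebra_fg`);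
  `stableAt_symbolicFG` — ⟨StableTower⟩ on the class; `coreFocusExistsOn_symbolicFG_of_invmaxClosed` — from slot W3.1's statement;
  `coreFocusExistsOn_lciOrMonomial_of_symbolicFG` — the W3.6 door is a COROLLARY of the SymbolicFG door.
* **`campaignW36CoreFocusExists_symbolicFG_holds p : CampaignW36CoreFocusExistsOnI SymbolicFGClass p`** — BINDER-FREE for every prime `p`
  (W3.1 `campaignW31UscInvOneExponentI_holds`, p491140, ∘ the door): for every perfect field of characteristic `p`, every ambient datum, every
  standard `E` with `0 < Ê.b` and certified edge data, IF the symbolic algebra `⊕_d 𝓘_{Σ̄_max}^{⟨d⟩}(U) X^d` is finitely generated on every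
  affine open `U`, THEN a core focusing `Ě` of `Ê` exists.
* NECESSITY, UNCONDITIONAL (res-type-010's p488059 `symbolicAlgebra_closure_fg_of_exists_isCoreFocus` re-keyed to the class, its two
  premises DISCHARGED by tree theorems: `Ě` standard by `isStandard_of_isCoreFocus_baseHike` (Thm6p6b, res-type-076 and res-type-010 lineage) and
  `U16_1 p A.hom Ě` by `U16_1_holds` (U16L38Holds, res-D-lib-2, over F-20d = `Hironaka2005.FinitePresentationTheorem_holds`)):
  **`symbolicFGClass_of_exists_isCoreFocus`** — if `Ê = baseHike E` (`J_E ≠ 0`, `0 < Ê.b`, any `inv`) has a core focusing then `(Ê, Σ_max)` is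
  in `SymbolicFGClass`; hence **`exists_isCoreFocus_iff_symbolicFGClass`** (given the cut equation) and, with ⟨UscCut⟩ from slot W3.1 by name,
  **`coreFocusExists_iff_symbolicFGClass`**: for every prime `p`, perfect `K`, ambient datum, standard `E` with `0 < Ê.b` and certified `ed`,
  «`Ě` exists ⟺ the symbolic algebra of `Σ̄_max(Ê)` is finitely generated on every affine open» — BINDER-FREE. So the residual of R12/12a off 𝒞
  is EXACTLY the classical question «is `⊕_d 𝓘_{Σ̄_max}^{⟨d⟩}` Noetherian»; such finite generation is known to FAIL for some closed subsets
  of regular varieties in positive characteristic (Sannai–Tanaka 2019 Thm 3.7; Kurano et al. 2025 Ex. 1.4 (2)) — literature, not kernel: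
  whether such a set occurs as `Σ̄_max(Ê)` of a typed datum is NOT decided here; no verdict.
* rev 2 appendix: **`hatStableTowerPos_iff_symbolicFGClass`** — the residual OF RECORD `CampaignW31.HatStableTowerPos edgeDataProvenance A n`
  (p485977) ⟺ «every guarded `(Ê, Σ_max)` is in `SymbolicFGClass`», binder-free.
* rev 3 appendix: `CampaignW36.symbolicFGClass_iff_top` — on an affine ambient, membership ⟺ ONE algebra `⊕_d 𝓘_{Σ̄}^{⟨d⟩}(W) X^d` is f.g.
-/

noncomputable section

set_option linter.dupNamespace false -- mandated namespace of this single-conjunct summit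

open _root_.AlgebraicGeometry _root_.TopologicalSpace _root_.CategoryTheory _root_.IsLocalRing

namespace Summit.ResolutionOfSingularities.ResolutionOfSingularities.Theorems

open Literature.AlgebraicGeometry.Resolution
open Literature.AlgebraicGeometry.Hironaka2017
open Literature.AlgebraicGeometry.Hironaka2017.S02Preliminaries
open Literature.AlgebraicGeometry.Hironaka2017.S04CharAlgebra
open Literature.AlgebraicGeometry.Hironaka2017.S06BaseHike
open Literature.AlgebraicGeometry.Hironaka2017.Datum
open Scheme.IdealSheafData

universe u

namespace CampaignW36

section Ambient

variable {IsEdgeData : ∀ ⦃X : Scheme.{u}⦄ ⦃p n : ℕ⦄ (E : IdealExponent X) (ξ : X), EdgeDatumAt p n E ξ → Prop}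
  {p : ℕ} [Fact p.Prime] {K : Type u} [Field K] [CharP K p]

/-- The ambient scheme of a row-001 `AmbientDatum` is Noetherian. [folklore] -/
private theorem ambient_isNoetherian''' (A : AmbientDatum p K) : IsNoetherian A.Z :=
  -- adapted from Literature/AlgebraicGeometry/Hironaka2017/Lib/CoreFocusVeronese.lean (private `ambient_isNoetherian'`)
  haveI := A.smooth
  haveI := A.quasiCompact
  Scheme.isNoetherian_of_finiteType_over_field A.hom

/-- **𝒞 ⊆ SymbolicFG on every ambient datum**: an `Inv_max`-stratum whose closure is an l.c.i. cut or a monomial cut at each of its points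
has finitely generated symbolic algebra on every affine open (`symbolicAlgebra_fg_lciOrMonomial`, T-AB p494780). NOT a statement of the
manuscript. [cite: HerzogHibiTrung2007, Thm 2.1, Cor. 2.2] -/
theorem symbolicFGClass_of_lciOrMonomialClass (A : AmbientDatum p K) (F : IdealExponent A.Z) (Sig : Set A.Z)
    (h : LCIOrMonomialClass F Sig) : SymbolicFGClass F Sig :=
  fun U => symbolicAlgebra_fg_lciOrMonomial A (Closeds.closure Sig) h U

/-- The B-type class lies in SymbolicFG (T-B p494780). NOT a statement of the manuscript. [cite: HerzogHibiTrung2007, Thm 2.1, Cor. 2.2] -/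
theorem symbolicFGClass_of_monomialClass (A : AmbientDatum p K) (F : IdealExponent A.Z) (Sig : Set A.Z)
    (h : MonomialClass F Sig) : SymbolicFGClass F Sig :=
  fun U => symbolicAlgebra_fg_monomial A (Closeds.closure Sig) h U

/-- **⟨StableTower⟩ ON SymbolicFG** (no level bound; `b₀` = the common Veronese level of `Σ̄_max`): for `E` on `A.Z` with `0 < Ê.b` and edge
data `ed`, membership of `(Ê, Σ_max)` in the class makes res-type-010's tower over `Σ̄_max` stable at some positive level
(`exists_stableAt_of_symbolicAlgebra_fg`). NOT a statement of the manuscript. [cite: HerzogHibiTrung2007, Thm 2.1 (a) ⇒ (b)] -/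
theorem stableAt_symbolicFG (A : AmbientDatum p K) {n : ℕ} (E : IdealExponent A.Z) (ed : EdgeDataOn p n (baseHike E))
    (hb : 0 < (baseHike E).b)
    (hC : SymbolicFGClass (baseHike E)
      (invmaxStratum ((baseHike E).sing ∩ S02Preliminaries.closedPoints A.Z) (invField (baseHike E) ed))) :
    ∃ b₀ : ℕ, 0 < b₀ ∧ StableAt (baseHike E)
      (CampaignW31.invmaxClosure ((baseHike E).sing ∩ S02Preliminaries.closedPoints A.Z) (invField (baseHike E) ed)) b₀ := by
  haveI := ambient_isNoetherian''' A
  exact exists_stableAt_of_symbolicAlgebra_fg A.isRegular_Z (baseHike E) hb _ hC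

variable [PerfectField K]

/-- **[OURS · L1 W3.6] THE SYMBOLIC-FG DOOR: ⟨UscCut⟩|SymbolicFG ⇒ `Ě` exists on SymbolicFG** — o4's `CoreFocusExistsOn` (p487786) on the class
`SymbolicFGClass`, from `exists_isCoreFocus_of_symbolicAlgebra_fg` (p525679) with `C := Σ̄_max = invmaxClosure`. NOT a statement of the manuscript.
[cite: HerzogHibiTrung2007, Thm 2.1 (a) ⇒ (b)] -/
theorem coreFocusExistsOn_symbolicFG_of_hatUscCutOn {A : AmbientDatum p K} {n : ℕ}
    (hU : HatUscCutOn SymbolicFGClass IsEdgeData A n) : CoreFocusExistsOn SymbolicFGClass IsEdgeData A n := by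
  intro E ed hE hb hed hC
  exact exists_isCoreFocus_of_symbolicAlgebra_fg A (invInst (baseHike E) ed) (baseHike E) hb
    (CampaignW31.invmaxClosure ((baseHike E).sing ∩ S02Preliminaries.closedPoints A.Z) (invField (baseHike E) ed))
    hC (hU E ed hE hb hed hC) subset_rfl

/-- **FROM SLOT W3.1**: `CampaignW31InvmaxClosed ⇒ Ě exists on SymbolicFG` (⟨UscCut⟩ on every class, p487786's `hatUscCutOn_of_invmaxClosed`).
NOT a statement of the manuscript. [cite: HerzogHibiTrung2007, Thm 2.1 (a) ⇒ (b)] -/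
theorem coreFocusExistsOn_symbolicFG_of_invmaxClosed (hW31 : CampaignW31InvmaxClosed.{u} IsEdgeData) {A : AmbientDatum p K}
    {n : ℕ} : CoreFocusExistsOn SymbolicFGClass IsEdgeData A n :=
  coreFocusExistsOn_symbolicFG_of_hatUscCutOn (hatUscCutOn_of_invmaxClosed hW31 K A n)

/-- **The W3.6 door is a corollary of the SymbolicFG door**: `Ě` exists on SymbolicFG ⇒ `Ě` exists on `𝒞 = LCIOrMonomialClass`
(𝒞 ⊆ SymbolicFG on the ambient datum). NOT a statement of the manuscript. [cite: HerzogHibiTrung2007, Thm 2.1, Cor. 2.2] -/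
theorem coreFocusExistsOn_lciOrMonomial_of_symbolicFG {A : AmbientDatum p K} {n : ℕ}
    (h : CoreFocusExistsOn SymbolicFGClass IsEdgeData A n) : CoreFocusExistsOn LCIOrMonomialClass IsEdgeData A n :=
  fun E ed hE hb hed hC => h E ed hE hb hed (symbolicFGClass_of_lciOrMonomialClass A _ _ hC)

/-! ### Necessity — unconditional (res-type-010's `U30L4fSymbolicFG` with its premises discharged by tree theorems) -/

/-- **NECESSITY, UNCONDITIONAL.** On the ambient datum over a perfect field: if `Ê = baseHike E` (`J_E ≠ 0`, `0 < Ê.b`; any `inv`) HAS a core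
focusing `Ě`, then `(Ê, Σ_max)` lies in `SymbolicFGClass` — `Ě` is standard (`isStandard_of_isCoreFocus_baseHike`), `℘(Ě)` is finitely
generated on the affine opens (`U16_1_holds`, the typed §4 p.16 l.39–46 sentence, a tree theorem over F-20d), and `℘(Ě,d) = 𝓘_{Σ̄_max}^{⟨d⟩}`
(res-type-010's `symbolicAlgebra_closure_fg_of_exists_isCoreFocus`, p488059). Kernel consequence of typed statements; nothing of the
manuscript asserted. [cite: HerzogHibiTrung2007, Thm 2.1] -/
theorem symbolicFGClass_of_exists_isCoreFocus (A : AmbientDatum p K) {n : ℕ}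
    (inv : IdealExponent A.Z → A.Z → EdgeInv n) (E : IdealExponent A.Z) (hJ : E.J ≠ ⊥) (hb : 0 < (baseHike E).b)
    (hex : ∃ Echeck : IdealExponent A.Z, IsCoreFocus S04CharAlgebra.pAlg inv (baseHike E) Echeck) :
    SymbolicFGClass (baseHike E)
      (invmaxStratum ((baseHike E).sing ∩ S02Preliminaries.closedPoints A.Z) (inv (baseHike E))) := by
  obtain ⟨Echeck, h⟩ := hex
  exact fun U => symbolicAlgebra_closure_fg_of_exists_isCoreFocus A inv (baseHike E) hb
    ⟨Echeck, h, isStandard_of_isCoreFocus_baseHike A inv E hJ hb h, U16_1_holds (K := K) p A.hom Echeck⟩ U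

/-- **«`Ě` exists ⟺ SymbolicFG», per instance, any `inv`**: on the ambient datum over a perfect field, for `Ê = baseHike E` (`J_E ≠ 0`,
`0 < Ê.b`) at an instance where the `Inv_max`-stratum `Σ` satisfies the cut equation `Σ̄ ∩ Sing(Ê)_cl = Σ` (⟨UscCut⟩): a core focusing
exists IFF the symbolic algebra `⊕_d 𝓘_{Σ̄}^{⟨d⟩}(U) X^d` is finitely generated on every affine open `U` (⇐ `exists_isCoreFocus_of_symbolicAlgebra_fg`,
⇒ `symbolicFGClass_of_exists_isCoreFocus`). NOT a statement of the manuscript; no verdict. [cite: HerzogHibiTrung2007, Thm 2.1] -/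
theorem exists_isCoreFocus_iff_symbolicFGClass (A : AmbientDatum p K) {n : ℕ}
    (inv : IdealExponent A.Z → A.Z → EdgeInv n) (E : IdealExponent A.Z) (hJ : E.J ≠ ⊥) (hb : 0 < (baseHike E).b)
    (hcut : closure (invmaxStratum ((baseHike E).sing ∩ S02Preliminaries.closedPoints A.Z) (inv (baseHike E))) ∩
        ((baseHike E).sing ∩ S02Preliminaries.closedPoints A.Z) =
      invmaxStratum ((baseHike E).sing ∩ S02Preliminaries.closedPoints A.Z) (inv (baseHike E))) :
    (∃ Echeck : IdealExponent A.Z, IsCoreFocus S04CharAlgebra.pAlg inv (baseHike E) Echeck) ↔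
      SymbolicFGClass (baseHike E)
        (invmaxStratum ((baseHike E).sing ∩ S02Preliminaries.closedPoints A.Z) (inv (baseHike E))) :=
  ⟨fun hex => symbolicFGClass_of_exists_isCoreFocus A inv E hJ hb hex,
    fun hFG => exists_isCoreFocus_of_symbolicAlgebra_fg A inv (baseHike E) hb
      (Closeds.closure (invmaxStratum ((baseHike E).sing ∩ S02Preliminaries.closedPoints A.Z) (inv (baseHike E))))
      hFG hcut subset_rfl⟩

end Ambient

end CampaignW36

open CampaignW36

/-! ## The `p`-slice, BINDER-FREE -/

/-- **[OURS · L1 W3.6] THE SYMBOLIC-FG DOOR HOLDS, BINDER-FREE: `CampaignW36CoreFocusExistsOnI SymbolicFGClass p` for every prime `p`** — for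
every perfect field `K` of characteristic `p`, every ambient datum `A`, every `n`, every standard `E` on `A.Z` with `0 < Ê.b` and every family of
edge data certified at `CampaignW31.edgeDataProvenance`: IF the symbolic (differential-power) algebra `⊕_d 𝓘_{Σ̄_max}^{⟨d⟩}(U) X^d` of the
closure of the `Inv_max`-stratum is a finitely generated `Γ(U)`-algebra on every affine open `U`, THEN a core focusing `Ě` of `Ê` exists.
Composition: slot W3.1 `campaignW31UscInvOneExponentI_holds` (res-type-076, p491140) ⇒ ⟨UscCut⟩ on every class (p487786) ⇒ the door
(`coreFocusExistsOn_symbolicFG_of_hatUscCutOn`). Contains the W3.6 door of record `campaignW36CoreFocusExists_lciOrMonomial_holds` (p494780)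
via `coreFocusExistsOn_lciOrMonomial_of_symbolicFG`. CLASS-RESTRICTED honesty: off SymbolicFG nothing is claimed; by
`exists_isCoreFocus_iff_symbolicFGClass` the class is also necessary (unconditionally: `coreFocusExists_iff_symbolicFGClass`). NOT a statement of the manuscript.
[cite: HerzogHibiTrung2007, Thm 2.1] -/
theorem campaignW36CoreFocusExists_symbolicFG_holds (p : ℕ) [Fact p.Prime] :
    CampaignW36CoreFocusExistsOnI.{u} SymbolicFGClass p :=
  fun K _ _ _ A n =>
    coreFocusExistsOn_symbolicFG_of_hatUscCutOn
      (hatUscCutOn_of_hatStratumClosedPos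
        (campaignW31HatStratumClosedPosI_of_uscInvOneExponentI p (campaignW31UscInvOneExponentI_holds p) K A n))

/-- **[OURS · L1 W3.6] R12/12a IS EXACTLY SYMBOLIC-FG — BINDER-FREE, PER INSTANCE, AT THE DOOR'S PROVENANCE.** For every prime `p`, every
perfect field `K` of characteristic `p`, every ambient datum `A`, every `n`, every STANDARD `E` on `A.Z` with `0 < Ê.b` and every family `ed` of
edge data of `Ê` certified at `CampaignW31.edgeDataProvenance`: a core focusing `Ě` of `Ê` (row 010d's typed `∃ Ě, IsCoreFocus ℘ (invInst Ê ed) Ê Ě`,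
the R12/12a apex at this instance) EXISTS IF AND ONLY IF the symbolic (differential-power) algebra `⊕_d 𝓘_{Σ̄_max}^{⟨d⟩}(U) X^d` of the closure
of the `Inv_max`-stratum is a finitely generated `Γ(U)`-algebra on every affine open `U`. The cut equation comes from slot W3.1 by name
(`campaignW31UscInvOneExponentI_holds`, p491140); ⇐ is the SymbolicFG door, ⇒ is `symbolicFGClass_of_exists_isCoreFocus`. HONESTY: this decides
OUR existence sentence relative to a classical property of `Σ̄_max`; it neither follows nor refutes the manuscript's (absent) argument p.30
l.5–9, and whether a typed `Ê` with NON-finitely-generated symbolic algebra of `Σ̄_max` exists is not decided here. NOT a statement of the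
manuscript. [cite: HerzogHibiTrung2007, Thm 2.1] -/
theorem coreFocusExists_iff_symbolicFGClass (p : ℕ) [Fact p.Prime] (K : Type u) [Field K] [CharP K p] [PerfectField K]
    (A : AmbientDatum p K) (n : ℕ) (E : IdealExponent A.Z) (ed : EdgeDataOn p n (baseHike E)) (hE : E.IsStandard)
    (hb : 0 < (baseHike E).b) (hed : IsEdgeDataOn CampaignW31.edgeDataProvenance (baseHike E) ed) :
    (∃ Echeck : IdealExponent A.Z, IsCoreFocus S04CharAlgebra.pAlg (invInst (baseHike E) ed) (baseHike E) Echeck) ↔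
      SymbolicFGClass (baseHike E)
        (invmaxStratum ((baseHike E).sing ∩ S02Preliminaries.closedPoints A.Z) (invField (baseHike E) ed)) :=
  exists_isCoreFocus_iff_symbolicFGClass A (invInst (baseHike E) ed) E hE.1 hb
    (hatUscCutOn_of_hatStratumClosedPos (𝒞 := fun _ _ _ => True)
      (campaignW31HatStratumClosedPosI_of_uscInvOneExponentI p (campaignW31UscInvOneExponentI_holds p) K A n)
      E ed hE hb hed trivial)

/-! ## Appendix (rev 2): the residual OF RECORD ⟨StableTower⟩ = `CampaignW31.HatStableTowerPos` is EXACTLY «SymbolicFG at every guarded instance» -/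

/-- **[OURS · L1 W3.6] ⟨StableTower⟩ ⟺ SymbolicFG ON ALL GUARDED INSTANCES, binder-free.** For every prime `p`, perfect `K` of characteristic
`p`, ambient datum `A` and `n`: the live residual of R12/12a of record, `CampaignW31.HatStableTowerPos edgeDataProvenance A n` (p485977: for
every standard `E` with `0 < Ê.b` and every certified `ed`, the tower over `Σ̄_max` is stable at some positive level), holds IF AND ONLY IF every
such `(Ê, Σ_max)` lies in `SymbolicFGClass` (symbolic algebra of `Σ̄_max` finitely generated on every affine open). (→: res-type-010's
`exists_isCoreFocus_iff_closure_ambient` with ⟨UscCut⟩ from W3.1 by name, then `symbolicFGClass_of_exists_isCoreFocus`; ←: `stableAt_symbolicFG`.)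
NOT a statement of the manuscript; no verdict on whether the right-hand side holds. [cite: HerzogHibiTrung2007, Thm 2.1] -/
theorem hatStableTowerPos_iff_symbolicFGClass (p : ℕ) [Fact p.Prime] (K : Type u) [Field K] [CharP K p] [PerfectField K]
    (A : AmbientDatum p K) (n : ℕ) :
    CampaignW31.HatStableTowerPos CampaignW31.edgeDataProvenance A n ↔
      ∀ (E : IdealExponent A.Z) (ed : EdgeDataOn p n (baseHike E)), E.IsStandard → 0 < (baseHike E).b →
        IsEdgeDataOn CampaignW31.edgeDataProvenance (baseHike E) ed →
          SymbolicFGClass (baseHike E)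
            (invmaxStratum ((baseHike E).sing ∩ S02Preliminaries.closedPoints A.Z) (invField (baseHike E) ed)) := by
  constructor
  · intro hST E ed hE hb hed
    obtain ⟨b₀, hb₀, hst⟩ := hST E ed hE hb hed
    have hcut := hatUscCutOn_of_hatStratumClosedPos (𝒞 := fun _ _ _ => True)
      (campaignW31HatStratumClosedPosI_of_uscInvOneExponentI p (campaignW31UscInvOneExponentI_holds p) K A n) E ed hE hb hed trivial
    exact symbolicFGClass_of_exists_isCoreFocus A (invInst (baseHike E) ed) E hE.1 hb
      ((exists_isCoreFocus_iff_closure_ambient A (invInst (baseHike E) ed) (baseHike E) hb).mpr ⟨hcut, b₀, hb₀, hst⟩)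
  · intro hFG E ed hE hb hed
    exact stableAt_symbolicFG A E ed hb (hFG E ed hE hb hed)

/-! ## Appendix (rev 3): on an AFFINE ambient, class membership is decided by ONE algebra -/

/-- **`SymbolicFGClass` on an affine ambient = finite generation of ONE algebra** (`⊕_d 𝓘_{Σ̄}^{⟨d⟩}(W) X^d` over `Γ(W, ⊤)`; locally Noetherian
affine `W`): by `CampaignW36.symbolicAlgebra_fg_iff_top` (rev 2 of `MarkedTransferCampaignW36SymbolicFG`). For the cone / specimen programme on
`𝔸ⁿ⁺¹` (res-type-009's device, res-L1-s36-pv-2's transfer): a (u)-instance check is ONE finite-generation question. NOT a statement of the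
manuscript. [cite: HerzogHibiTrung2007, Thm 2.1] -/
theorem CampaignW36.symbolicFGClass_iff_top {W : Scheme.{u}} [IsAffine W] [IsLocallyNoetherian W] (F : IdealExponent W) (Sig : Set W) :
    CampaignW36.SymbolicFGClass F Sig ↔
      (familySubalgebra Γ(W, (⟨⊤, isAffineOpen_top W⟩ : W.affineOpens))
        fun d => (diffPower (Closeds.closure Sig) d).ideal ⟨⊤, isAffineOpen_top W⟩).FG :=
  CampaignW36.symbolicAlgebra_fg_iff_top (Closeds.closure Sig)

end Summit.ResolutionOfSingularities.ResolutionOfSingularities.Theorems
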